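import Mathlib
import Summits.KontsevichZagierPeriods.KontsevichZagierPeriods.Theorems.SoloInformedDivisionThreeCirc
import Summits.KontsevichZagierPeriods.KontsevichZagierPeriods.Theorems.SoloInformedDivisionNeg
import HarnessLib
import HarnessLib.Audit

/-!
# Division by translation XII: the negative trisection packets in closed form (solo-informed, s43)

Part X (THEOREM XXIX(iii) KERNEL, `soloInformed_divChain_negative`) on the trisection chain of part VIII
(`m′ = (2s−1)/(s³(2−s))`, `½ < s < 1` real algebraic, `σ = √(s(2−s))`, circular scalar `c = m′sσ` at both division
points — part XI) gives, for the complementary modulus `m = 1 − m′` and ALL representations,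

  **`⟦Π(−(1−s²)/s² | m)⟧ = ⟦[pt, (s²−s+1)/3]⟧·⟦K(m)⟧ + ⟦[pt, sσ/3]⟧·⟦π⟧`**            (`soloInformed_trisection_negative`),
  **`⟦Π(−(1−s)²/(s(2−s)) | m)⟧ = ⟦[pt, (1+s)(2−s)/3]⟧·⟦K(m)⟧ + ⟦[pt, sσ/6]⟧·⟦π⟧`**    (`soloInformed_trisection_negative₂`),

e.g. `s = ⅔` (`m = 5/32`): `27·Π(−5/4 | 5/32) = 7K + 4√2·π`, `27·Π(−⅛ | 5/32) = 20K + 2√2·π` (floats `10⁻¹⁴`).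
With parts VIII (hyperbolic) and XI (circular) this completes the trisection packet in closed form in one parameter.
References: Abramowitz–Stegun 17.7; Kontsevich–Zagier, *Periods* (2001), §1.2; this work.
-/

noncomputable section

open MeasureTheory Set Filter
open scoped Classical

open Literature.NumberTheory.Transcendental Literature.NumberTheory.Transcendental.KZ
open Literature.ModelTheory.ExponentialFields

namespace Summit.KontsevichZagierPeriods.KontsevichZagierPeriods.Theorems
/-- **COROLLARY (negative trisection packet, closed form; THEOREM XXIX(iii) at order 3).** For every real
algebraic `½ < s < 1`, `m = 1 − (2s−1)/(s³(2−s))`, `N = −(1−s²)/s²`, and all representations: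
`⟦Π(N | m)⟧ = ⟦[pt,(s²−s+1)/3]⟧·⟦K(m)⟧ + ⟦[pt, s√(s(2−s))/3]⟧·⟦π⟧`. [this work] -/
theorem soloInformed_trisection_negative (s : ℝ) (hs : s ∈ Ioo (1/2:ℝ) 1) (hsa : IsAlgebraic ℚ s)
    (PN K : IntegralRep 1) (hPNd : PN.domain = {x | x 0 ∈ Ioo (0:ℝ) 1})
    (hPNi : EqOn PN.integrand (fun x => (1 + (1 - s ^ 2) / s ^ 2 * x 0 ^ 2)⁻¹ *
      ((√(1 - x 0 ^ 2))⁻¹ * (√(1 - (1 - (2 * s - 1) / (s ^ 3 * (2 - s))) * x 0 ^ 2))⁻¹))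
      PN.domain)
    (hKd : K.domain = {x | x 0 ∈ Ioo (0:ℝ) 1})
    (hKi : EqOn K.integrand (fun x => (√(1 - x 0 ^ 2))⁻¹ *
      (√(1 - (1 - (2 * s - 1) / (s ^ 3 * (2 - s))) * x 0 ^ 2))⁻¹) K.domain) :
    IsAlgebraic ℚ ((s ^ 2 - s + 1) / 3) ∧ IsAlgebraic ℚ (s * √(s * (2 - s)) / 3) ∧
      ∀ (hA : IsAlgebraic ℚ ((s ^ 2 - s + 1) / 3)) (hB : IsAlgebraic ℚ (s * √(s * (2 - s)) / 3)),
        toFormalPeriod (of PN) =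
          toFormalPeriod (of (IntegralRep.unit.constMul _ hA)) * toFormalPeriod (of K) +
            toFormalPeriod (of (IntegralRep.unit.constMul _ hB)) * toFormalPeriod (of KZ.piRep) := by
  have hm := soloInformed_m3_mem hs
  have hma := soloInformed_m3_isAlgebraic hsa
  obtain ⟨f1, -, -, -⟩ := soloInformed_s3_facts hs
  obtain ⟨hσ, hsq, -, -, -, -⟩ := soloInformed_s3_sqrt hs
  have hc := soloInformed_trisection_circScalar hs
  have h0 : s ≠ 0 := (by linarith [hs.1] : (0:ℝ) < s).ne'
  have h21 : 2 * s - 1 ≠ 0 := (by linarith [hs.1] : (0:ℝ) < 2 * s - 1).ne'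
  have h1s : 1 - s ^ 2 ≠ 0 := (by nlinarith [hs.1, hs.2] : (0:ℝ) < 1 - s ^ 2).ne'
  have h2 : 2 - s ≠ 0 := (by linarith [hs.2] : (0:ℝ) < 2 - s).ne'
  have hm0 : soloInformedM3 s ≠ 0 := hm.1.ne'
  have h3a : IsAlgebraic ℚ (3:ℝ) := by simpa using isAlgebraic_nat (R := ℚ) (A := ℝ) 3
  have hσa : IsAlgebraic ℚ (√(s * (2 - s))) := by
    have h := (soloInformed_divChain_mem (soloInformedDivChainThree s hs hsa) hm hma 2
      (by norm_num)).2
    rwa [soloInformed_divChainThree_s, soloInformed_s3_two] at h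
  have hA : IsAlgebraic ℚ ((s ^ 2 - s + 1) / 3) := by
    rw [div_eq_mul_inv]; exact (((hsa.pow 2).sub hsa).add isAlgebraic_one).mul h3a.inv
  have hB : IsAlgebraic ℚ (s * √(s * (2 - s)) / 3) := by
    rw [div_eq_mul_inv]; exact (hsa.mul hσa).mul h3a.inv
  have hS1 : (soloInformedDivChainThree s hs hsa).s 1 = s := soloInformed_s3_one
  have hPNi' : EqOn PN.integrand (fun x => (1 + (1 - (soloInformedDivChainThree s hs hsa).s 1 ^ 2) /
      (soloInformedDivChainThree s hs hsa).s 1 ^ 2 * x 0 ^ 2)⁻¹ *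
      ((√(1 - x 0 ^ 2))⁻¹ * (√(1 - (1 - (2 * s - 1) / (s ^ 3 * (2 - s))) * x 0 ^ 2))⁻¹))
      PN.domain := by
    intro x hx
    rw [hPNi hx, hS1]
  refine ⟨hA, hB, fun hA' hB' => ?_⟩
  obtain ⟨a, b, ha, hb, h, rfl, rfl⟩ := soloInformed_divChain_negative
    (soloInformedDivChainThree s hs hsa) hm hma (p := 1) one_pos (by norm_num) PN K hPNd hPNi' hKd hKi
  rw [h ha hb, soloInformed_pointRep_congr ha hA' ?_, soloInformed_pointRep_congr hb hB' ?_]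
  · -- `b' = s²·m′(1−s²)B/(1−m′s²) = sσ/3`
    set σ := √(s * (2 - s))
    have hσ0 : σ ≠ 0 := hσ.ne'
    rw [hS1, hc, f1, ← hsq]
    push_cast
    field_simp
    ring
  · -- `a' = s²·((1−m′) + m′(1−s²)A)/(1−m′s²) = (s²−s+1)/3`, using `A = (2−s)/3` first
    rw [hS1, soloInformed_divChainThree_zeta hs hsa, SoloInformedDivChain.zeta_one, hc, f1]
    have hσ0 : √(s * (2 - s)) ≠ 0 := hσ.ne'
    have hAraw : (1:ℝ) - ((3:ℕ) * (soloInformedM3 s * s * √(s * (2 - s))))⁻¹ *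
        ((1:ℕ) * (soloInformedM3 s * s * (s * √(s * (2 - s)) + √(s * (2 - s)))) - (3:ℕ) * 0) =
          (2 - s) / 3 := by
      push_cast; field_simp; ring
    rw [hAraw]
    unfold soloInformedM3
    field_simp
    ring

/-- **COROLLARY (negative trisection packet), numerically:** `Π(−(1−s²)/s² | m) = (s²−s+1)/3·K +
s√(s(2−s))/3·π`, `m = 1 − (2s−1)/(s³(2−s))` (e.g. `27Π(−5/4|5/32) = 7K + 4√2π`). [this work] -/
theorem soloInformed_trisection_negative_value (s : ℝ) (hs : s ∈ Ioo (1/2:ℝ) 1)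
    (hsa : IsAlgebraic ℚ s)
    (PN K : IntegralRep 1) (hPNd : PN.domain = {x | x 0 ∈ Ioo (0:ℝ) 1})
    (hPNi : EqOn PN.integrand (fun x => (1 + (1 - s ^ 2) / s ^ 2 * x 0 ^ 2)⁻¹ *
      ((√(1 - x 0 ^ 2))⁻¹ * (√(1 - (1 - (2 * s - 1) / (s ^ 3 * (2 - s))) * x 0 ^ 2))⁻¹))
      PN.domain)
    (hKd : K.domain = {x | x 0 ∈ Ioo (0:ℝ) 1})
    (hKi : EqOn K.integrand (fun x => (√(1 - x 0 ^ 2))⁻¹ *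
      (√(1 - (1 - (2 * s - 1) / (s ^ 3 * (2 - s))) * x 0 ^ 2))⁻¹) K.domain) :
    PN.value = (s ^ 2 - s + 1) / 3 * K.value + s * √(s * (2 - s)) / 3 * Real.pi := by
  obtain ⟨hA, hB, h⟩ := soloInformed_trisection_negative s hs hsa PN K hPNd hPNi hKd hKi
  have e := congrArg evalP (h hA hB)
  simpa only [map_mul, map_add, evalP_toFormalPeriod_of, IntegralRep.value_constMul,
    IntegralRep.value_unit, mul_one, KZ.piRep_value] using e

/-- **COROLLARY (negative trisection packet at the second division point).** For every real algebraic `½ < s < 1`,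
`m = 1 − (2s−1)/(s³(2−s))`, `N = −(1−σ²)/σ² = −(1−s)²/(s(2−s))`, and all representations:
`⟦Π(N | m)⟧ = ⟦[pt,(1+s)(2−s)/3]⟧·⟦K(m)⟧ + ⟦[pt, s√(s(2−s))/6]⟧·⟦π⟧`. [this work] -/
theorem soloInformed_trisection_negative₂ (s : ℝ) (hs : s ∈ Ioo (1/2:ℝ) 1) (hsa : IsAlgebraic ℚ s)
    (PN K : IntegralRep 1) (hPNd : PN.domain = {x | x 0 ∈ Ioo (0:ℝ) 1})
    (hPNi : EqOn PN.integrand (fun x => (1 + (1 - s) ^ 2 / (s * (2 - s)) * x 0 ^ 2)⁻¹ *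
      ((√(1 - x 0 ^ 2))⁻¹ * (√(1 - (1 - (2 * s - 1) / (s ^ 3 * (2 - s))) * x 0 ^ 2))⁻¹))
      PN.domain)
    (hKd : K.domain = {x | x 0 ∈ Ioo (0:ℝ) 1})
    (hKi : EqOn K.integrand (fun x => (√(1 - x 0 ^ 2))⁻¹ *
      (√(1 - (1 - (2 * s - 1) / (s ^ 3 * (2 - s))) * x 0 ^ 2))⁻¹) K.domain) :
    IsAlgebraic ℚ ((1 + s) * (2 - s) / 3) ∧ IsAlgebraic ℚ (s * √(s * (2 - s)) / 6) ∧
      ∀ (hA : IsAlgebraic ℚ ((1 + s) * (2 - s) / 3)) (hB : IsAlgebraic ℚ (s * √(s * (2 - s)) / 6)),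
        toFormalPeriod (of PN) =
          toFormalPeriod (of (IntegralRep.unit.constMul _ hA)) * toFormalPeriod (of K) +
            toFormalPeriod (of (IntegralRep.unit.constMul _ hB)) * toFormalPeriod (of KZ.piRep) := by
  have hm := soloInformed_m3_mem hs
  have hma := soloInformed_m3_isAlgebraic hsa
  obtain ⟨-, -, f3, -⟩ := soloInformed_s3_facts hs
  obtain ⟨hσ, hsq, -, -, -, -⟩ := soloInformed_s3_sqrt hs
  have hc := soloInformed_trisection_circScalar₂ hs
  have h0 : s ≠ 0 := (by linarith [hs.1] : (0:ℝ) < s).ne'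
  have h1 : 1 - s ≠ 0 := (by linarith [hs.2] : (0:ℝ) < 1 - s).ne'
  have h21 : 2 * s - 1 ≠ 0 := (by linarith [hs.1] : (0:ℝ) < 2 * s - 1).ne'
  have h2 : 2 - s ≠ 0 := (by linarith [hs.2] : (0:ℝ) < 2 - s).ne'
  have hm0 : soloInformedM3 s ≠ 0 := hm.1.ne'
  have h2a : IsAlgebraic ℚ (2:ℝ) := by simpa using isAlgebraic_nat (R := ℚ) (A := ℝ) 2
  have h3a : IsAlgebraic ℚ (3:ℝ) := by simpa using isAlgebraic_nat (R := ℚ) (A := ℝ) 3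
  have h6a : IsAlgebraic ℚ (6:ℝ) := by simpa using isAlgebraic_nat (R := ℚ) (A := ℝ) 6
  have hσa : IsAlgebraic ℚ (√(s * (2 - s))) := by
    have h := (soloInformed_divChain_mem (soloInformedDivChainThree s hs hsa) hm hma 2
      (by norm_num)).2
    rwa [soloInformed_divChainThree_s, soloInformed_s3_two] at h
  have hA : IsAlgebraic ℚ ((1 + s) * (2 - s) / 3) := by
    rw [div_eq_mul_inv]; exact ((isAlgebraic_one.add hsa).mul (h2a.sub hsa)).mul h3a.inv
  have hB : IsAlgebraic ℚ (s * √(s * (2 - s)) / 6) := by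
    rw [div_eq_mul_inv]; exact (hsa.mul hσa).mul h6a.inv
  have hS2 : (soloInformedDivChainThree s hs hsa).s 2 = √(s * (2 - s)) := soloInformed_s3_two
  have f5 : 1 - s * (2 - s) = (1 - s) ^ 2 := by ring
  have hPNi' : EqOn PN.integrand (fun x => (1 + (1 - (soloInformedDivChainThree s hs hsa).s 2 ^ 2) /
      (soloInformedDivChainThree s hs hsa).s 2 ^ 2 * x 0 ^ 2)⁻¹ *
      ((√(1 - x 0 ^ 2))⁻¹ * (√(1 - (1 - (2 * s - 1) / (s ^ 3 * (2 - s))) * x 0 ^ 2))⁻¹))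
      PN.domain := by
    intro x hx
    rw [hPNi hx, hS2, hsq, f5]
  refine ⟨hA, hB, fun hA' hB' => ?_⟩
  obtain ⟨a, b, ha, hb, h, rfl, rfl⟩ := soloInformed_divChain_negative
    (soloInformedDivChainThree s hs hsa) hm hma (p := 2) two_pos (by norm_num) PN K hPNd hPNi' hKd hKi
  rw [h ha hb, soloInformed_pointRep_congr ha hA' ?_, soloInformed_pointRep_congr hb hB' ?_]
  · -- `b' = σ²·m′(1−σ²)B/(1−m′σ²) = sσ/6`
    set σ := √(s * (2 - s))
    have hσ0 : σ ≠ 0 := hσ.ne'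
    have f3' : 1 - soloInformedM3 s * σ ^ 2 = (1 - s) ^ 2 / s ^ 2 := by rw [hsq]; exact f3
    have f5' : 1 - σ ^ 2 = (1 - s) ^ 2 := by rw [hsq]; exact f5
    rw [hS2, hc, f3', f5']
    push_cast
    field_simp
    ring
  · -- `a' = σ²·((1−m′) + m′(1−σ²)A)/(1−m′σ²) = (1+s)(2−s)/3`, using `A = (1+s)/3` first
    rw [hS2, soloInformed_divChainThree_zeta hs hsa, soloInformed_divChainThree_zeta₂ hs hsa, hc]
    have hσ0 : √(s * (2 - s)) ≠ 0 := hσ.ne'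
    have hAraw : (1:ℝ) - ((3:ℕ) * (soloInformedM3 s * s * √(s * (2 - s))))⁻¹ *
        ((2:ℕ) * (soloInformedM3 s * s * (s * √(s * (2 - s)) + √(s * (2 - s)))) -
          (3:ℕ) * (soloInformedM3 s * s * (s * √(s * (2 - s))))) = (1 + s) / 3 := by
      push_cast; field_simp; ring
    rw [hAraw, hsq, f3, f5]
    unfold soloInformedM3
    field_simp
    ring

/-- **COROLLARY (negative packet, second point), numerically:** `Π(−(1−s)²/(s(2−s)) | m) = (1+s)(2−s)/3·K +
s√(s(2−s))/6·π`, `m = 1 − (2s−1)/(s³(2−s))` (e.g. `27Π(−⅛|5/32) = 20K + 2√2π`). [this work] -/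
theorem soloInformed_trisection_negative₂_value (s : ℝ) (hs : s ∈ Ioo (1/2:ℝ) 1)
    (hsa : IsAlgebraic ℚ s)
    (PN K : IntegralRep 1) (hPNd : PN.domain = {x | x 0 ∈ Ioo (0:ℝ) 1})
    (hPNi : EqOn PN.integrand (fun x => (1 + (1 - s) ^ 2 / (s * (2 - s)) * x 0 ^ 2)⁻¹ *
      ((√(1 - x 0 ^ 2))⁻¹ * (√(1 - (1 - (2 * s - 1) / (s ^ 3 * (2 - s))) * x 0 ^ 2))⁻¹))
      PN.domain)
    (hKd : K.domain = {x | x 0 ∈ Ioo (0:ℝ) 1})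
    (hKi : EqOn K.integrand (fun x => (√(1 - x 0 ^ 2))⁻¹ *
      (√(1 - (1 - (2 * s - 1) / (s ^ 3 * (2 - s))) * x 0 ^ 2))⁻¹) K.domain) :
    PN.value = (1 + s) * (2 - s) / 3 * K.value + s * √(s * (2 - s)) / 6 * Real.pi := by
  obtain ⟨hA, hB, h⟩ := soloInformed_trisection_negative₂ s hs hsa PN K hPNd hPNi hKd hKi
  have e := congrArg evalP (h hA hB)
  simpa only [map_mul, map_add, evalP_toFormalPeriod_of, IntegralRep.value_constMul,
    IntegralRep.value_unit, mul_one, KZ.piRep_value] using e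

end Summit.KontsevichZagierPeriods.KontsevichZagierPeriods.Theorems

end
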